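import Summits.ResolutionOfSingularities.ResolutionOfSingularities.Theorems.HomologicalConductorNoZenoSplitFibreTwoPoints
import HarnessLib

/-!
# Crux `NoZenoR` (stmt-ResolutionOfSingularities-19943), β layer, slot 5 seam0 (d) / (HTWO): the FIELD STEP `hfibre`
# — two points over `(y, z₁)` from the splitting clause at `y`, with the residue-field square threaded

Route `ResolutionOfSingularities/HomologicalConductor`, crux chain W4.4.  OURS (cell res-hironaka; object (d) of res-L0-w44-lead-1's
(F-out) SHAPE 2026-08-27T21:56:28Z, hand res-D-pv-039; consumer: the `hfibre` binder of res-L0-w44-stub-4's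
`htwo_discharge_of_inter` (p576385) inside the slot-5 closer).  Pure residue-field plumbing over Mathlib feeding
res-D-pv-039's (S2a) `SplitFibre.exists_two_primes_of_ringHom` (p572328); AI-written, weaker than expert review; nothing
here is a statement of the manuscript under review (Hironaka 2017); no Theses file is imported.  Def-free, fact-free,
`--supports 19943 --as helper`.

Setting: two squares over the one-root base change `g : Spec D_f → Spec D` — `σ ≫ π = π_f ≫ g` (`π : X → Spec D`,
`π_f : X_f → Spec D_f`, `σ : X_f → X`) and the node blow-up `ρ : X¹ → X`; a point `y ∈ X¹`, a point `z₁ ∈ X_f` with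
`σ z₁ = ρ y` and `π_f z₁ = 𝔪_{D_f}`.

* `residueFieldMap_square` — the residue-field square at `(z₁, ρ y)`: `κ_D(π (ρ y)) → κ(ρ y) → κ(z₁)` equals
  `κ_D(π (ρ y)) ≅ κ_D(g 𝔪_f) → κ_{D_f}(𝔪_f) ≅ κ_{D_f}(π_f z₁) → κ(z₁)` (`residueFieldMap_comp` / `_congr` / `_congr'`);
* **`hfibre_of_splitting`** — in the literal `hfibre` currency of `htwo_discharge_of_inter` (algebras
  `(ρ.residueFieldMap y)` and `((X.residueFieldCongr h).inv ≫ σ.residueFieldMap z₁)`): if `κ(ρ y)` is algebraic over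
  `κ_D(π (ρ y))` (`halg`, a closed point of the closed fibre) and `κ(𝔪_{D_f})` splits the separable closure of `κ_D` in
  `κ(y)` (`hsplit`, the clause of `exists_splitting_threadPoly` at `y`), then `2 ≤ [κ(y) : κ(ρ y)]_s` gives two distinct
  points of `Spec (κ(y) ⊗_{κ(ρ y)} κ(z₁))`.

References: J. Lipman, Publ. Math. IHÉS 36 (1969) §16 (16.1) p. 231 (context) [`Lipman1969`].
-/

noncomputable section

-- single-problem summit: the doubled namespace component `ResolutionOfSingularities` is forced
set_option linter.dupNamespace false

namespace Summit.ResolutionOfSingularities.ResolutionOfSingularities.Theorems.NoZeno.ExcCount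

open CategoryTheory AlgebraicGeometry IsLocalRing
open scoped TensorProduct

variable {D Df : Type} [CommRing D] [CommRing Df] [IsLocalRing Df]
  {X X1 Xf : Scheme.{0}} (π : X ⟶ Spec (.of D)) (ρ : X1 ⟶ X) (σ : Xf ⟶ X) (πf : Xf ⟶ Spec (.of Df))
  (g : Spec (.of Df) ⟶ Spec (.of D)) (hsq : σ ≫ π = πf ≫ g)

omit [IsLocalRing Df] in
include hsq in
/-- **The residue-field square at a point of `X_f` over the closed point.**  For `σ ≫ π = π_f ≫ g`, `z₁ ∈ X_f` with
`π_f z₁ = p` and `σ z₁ = x`, and `hy : g p = π x`: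
`π.residueFieldMap x ≫ σ.residueFieldMap z₁` (through `κ(x) = κ(σ z₁)`) equals
`κ_D(π x) ≅ κ_D(g p) → κ_{D_f}(p) ≅ κ_{D_f}(π_f z₁) → κ(z₁)`. [folklore] -/
theorem residueFieldMap_square (z₁ : Xf) {x : X} (h : σ.base z₁ = x) {p : Spec (.of Df)} (hz₁ : πf.base z₁ = p)
    (hy : g.base p = π.base x) :
    π.residueFieldMap x ≫ (X.residueFieldCongr h).inv ≫ σ.residueFieldMap z₁ =
      ((Spec (.of D)).residueFieldCongr hy).inv ≫ g.residueFieldMap p ≫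
        ((Spec (.of Df)).residueFieldCongr hz₁).inv ≫ πf.residueFieldMap z₁ := by
  subst h hz₁
  rw [Scheme.residueFieldCongr_refl, Scheme.residueFieldCongr_refl, Iso.refl_inv, Iso.refl_inv,
    Category.id_comp, Category.id_comp, ← Scheme.residueFieldMap_comp, ← Scheme.residueFieldMap_comp,
    Scheme.Hom.residueFieldMap_congr hsq z₁]
  rfl

omit [IsLocalRing Df] in
include hsq in
/-- Elementwise form of `residueFieldMap_square`. [folklore] -/
theorem residueFieldMap_square_apply (z₁ : Xf) {x : X} (h : σ.base z₁ = x) {p : Spec (.of Df)}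
    (hz₁ : πf.base z₁ = p) (hy : g.base p = π.base x) (a : (Spec (.of D)).residueField (π.base x)) :
    ((X.residueFieldCongr h).inv ≫ σ.residueFieldMap z₁).hom ((π.residueFieldMap x).hom a) =
      (((Spec (.of Df)).residueFieldCongr hz₁).inv ≫ πf.residueFieldMap z₁).hom
        ((((Spec (.of D)).residueFieldCongr hy).inv ≫ g.residueFieldMap p).hom a) := by
  have hsqr := residueFieldMap_square π σ πf g hsq z₁ h hz₁ hy
  have := congrArg (fun φ => φ.hom a) hsqr
  simp only [CommRingCat.hom_comp, RingHom.comp_apply] at this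
  simp only [CommRingCat.hom_comp, RingHom.comp_apply]
  exact this

include hsq in
/-- **(d) The field step `hfibre` from the splitting clause.**  In the literal currency of `htwo_discharge_of_inter`'s
`hfibre` binder: `y ∈ X¹`, `z₁ ∈ X_f` over `ρ y` (`h`) and over the closed point of `D_f` (`hz₁`), `hy : g 𝔪_f = π (ρ y)`;
if `κ(ρ y)` is ALGEBRAIC over `κ_D(π (ρ y))` (`halg`) and `κ(𝔪_{D_f})` SPLITS the separable closure of `κ_D(π (ρ y))` in
`κ(y)` (`hsplit` — the clause of `exists_splitting_threadPoly` / `exists_splittingField` at `y` for `ρ ≫ π`), then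
`2 ≤ [κ(y) : κ(ρ y)]_s` yields two distinct points of `Spec (κ(y) ⊗_{κ(ρ y)} κ(z₁))` ((S2a)
`SplitFibre.exists_two_primes_of_ringHom` with the square `residueFieldMap_square`). [this work] -/
theorem hfibre_of_splitting (y : X1) (z₁ : Xf) (h : σ.base z₁ = ρ.base y) (hz₁ : πf.base z₁ = closedPoint Df)
    (hy : g.base (closedPoint Df) = (ρ ≫ π).base y)
    (halg : letI := (π.residueFieldMap (ρ.base y)).hom.toAlgebra
      Algebra.IsAlgebraic ((Spec (.of D)).residueField (π.base (ρ.base y))) (X.residueField (ρ.base y)))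
    (hsplit : letI := ((ρ ≫ π).residueFieldMap y).hom.toAlgebra
      letI := (((Spec (.of D)).residueFieldCongr hy).inv ≫ g.residueFieldMap (closedPoint Df)).hom.toAlgebra
      ∀ x : separableClosure ((Spec (.of D)).residueField ((ρ ≫ π).base y)) (X1.residueField y),
        ((minpoly ((Spec (.of D)).residueField ((ρ ≫ π).base y)) x).map
          (algebraMap ((Spec (.of D)).residueField ((ρ ≫ π).base y))
            ((Spec (.of Df)).residueField (closedPoint Df)))).Splits) :
    letI := (ρ.residueFieldMap y).hom.toAlgebra
    letI := ((X.residueFieldCongr h).inv ≫ σ.residueFieldMap z₁).hom.toAlgebra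
    2 ≤ Module.finrank (X.residueField (ρ.base y))
        (separableClosure (X.residueField (ρ.base y)) (X1.residueField y)) →
      ∃ q q' : PrimeSpectrum (X1.residueField y ⊗[X.residueField (ρ.base y)] Xf.residueField z₁), q ≠ q' := by
  intro h2
  have htower : ∀ a, ((ρ ≫ π).residueFieldMap y).hom a =
      (ρ.residueFieldMap y).hom ((π.residueFieldMap (ρ.base y)).hom a) := by
    intro a
    rw [Scheme.residueFieldMap_comp]
    rfl
  have hcomm : ∀ a, ((X.residueFieldCongr h).inv ≫ σ.residueFieldMap z₁).hom ((π.residueFieldMap (ρ.base y)).hom a) =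
      (((Spec (.of Df)).residueFieldCongr hz₁).inv ≫ πf.residueFieldMap z₁).hom
        ((((Spec (.of D)).residueFieldCongr hy).inv ≫ g.residueFieldMap (closedPoint Df)).hom a) :=
    fun a => residueFieldMap_square_apply π σ πf g hsq z₁ h hz₁ hy a
  obtain ⟨P, Q, hP, hQ, hne⟩ := SplitFibre.exists_two_primes_of_ringHom
    ((π.residueFieldMap (ρ.base y)).hom) ((ρ.residueFieldMap y).hom) (((ρ ≫ π).residueFieldMap y).hom) htower
    ((((Spec (.of D)).residueFieldCongr hy).inv ≫ g.residueFieldMap (closedPoint Df)).hom)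
    (((X.residueFieldCongr h).inv ≫ σ.residueFieldMap z₁).hom)
    ((((Spec (.of Df)).residueFieldCongr hz₁).inv ≫ πf.residueFieldMap z₁).hom) hcomm halg hsplit h2
  exact ⟨⟨P, hP⟩, ⟨Q, hQ⟩, fun e => hne (congrArg PrimeSpectrum.asIdeal e)⟩

end Summit.ResolutionOfSingularities.ResolutionOfSingularities.Theorems.NoZeno.ExcCount

end
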